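import Summits.MatrixMultiplication.MatrixMultiplication.Theorems.FarEdgeDescentAnchorTax
import HarnessLib

/-!
# Far-edge descent, kernel XXXVII-A: one-step inequalities of the EXACT readout of a product-and-reanchor step

Route `FarEdgeDescent`, special leaf `FiniteSaturation` (stmt-MatrixMultiplication-23739): helper
kernel, THESES-FREE and def-free; the scalar steps behind kernel XXXVII-B
(`FarEdgeDescentExactCeiling.exact_ceiling`: the exact readouts of EVERY product-and-full-reanchor
schedule pass on a full wedge `s − 1 ≤ c(1−t)^κ`, `κ = log₂(4/3)`, so the order of the whole exact
toolbox is `θ_S = log(4/3)/log(3/2) = 0.70951…`).  In the normalised exact readout `F = (Q^t + G)/r =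
1 − λ + X` (`λ = L/r ≤ 1/3` the leg share, `ℓ = log r`, `σ = s − 1`, `τ = 1 − t`) a product step obeys
`F'' ≤ F·F' + 2λλ'·e`, `e = min(1, (2LL')^{−τ})` (the dictionary is kernel XXXVII-C,
`FarEdgeDescentExactDictionary.exact_product_step`), and `λ'' = λ + λ' − 3λλ'`:

* §1 `product_normalForm` (`X'' ≤ (1−λ')X + (1−λ)X' + XX' − 2λλ'(1−e)`), `deep_step` (the margin
  `F ≤ 1 − λ/2` is hereditary once `e ≤ 5/8`, with the exact constant), `baseFed_step` (a base parent with
  excess `≤ λ_B/3` keeps `F ≤ 1`), `cross_term_comparable`, `potential_absorb`, `rpow_comparable`,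
  `lam_rpow_exchange`, `potential_over_lam`, `excess_le`;
* §2 `shallow_step` — the leg-mass tax of kernel XXXVI-A (`legMass_step`) WITH the exact cross term:
  comparable parents cost a factor `1 + Cσℓ^κ` absorbed by the geometric growth of `ℓ^κ`; an unbalanced
  small parent is paid by the contraction `1 − λ_b` of the big parent's excess.

References: Schönhage 1981, §5; Pan 1984 (LNCS 179) §16 Props. 16.2–16.5; Stothers 2010, Thm. 8;
Hardy–Littlewood–Pólya, Thm. 13.
Tags: `FiniteSaturation` (h₁) NEC · WEAKER · ATTACKED; support for the exact ceiling (XXXVII-B).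
-/

set_option linter.dupNamespace false

noncomputable section

namespace Summit.MatrixMultiplication.MatrixMultiplication.Theorems.FarEdgeDescentExactSteps

open Summit.MatrixMultiplication.MatrixMultiplication.Theorems.FarEdgeDescentImprovableRate
open Summit.MatrixMultiplication.MatrixMultiplication.Theorems.FarEdgeDescentAnchorTax

/-! ## §1 One-step inequalities for the exact normalised readout `F = (Q^t + G)/r` -/

/-- **Product normal form.**  `0 ≤ F ≤ 1 − λ + A`, `0 ≤ F' ≤ 1 − λ' + B` and the exact step
`F'' ≤ F·F' + 2λλ'·e` give `F'' ≤ 1 − λ'' + (1−λ')A + (1−λ)B + AB − 2λλ'(1−e)`, `λ'' = λ+λ'−3λλ'`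
(because `(1−λ)(1−λ') + 2λλ' = 1 − λ''`). [folklore] -/
theorem product_normalForm {u v A B Fa Fb Fj e : ℝ} (hFa0 : 0 ≤ Fa) (hFa : Fa ≤ 1 - u + A)
    (hFb0 : 0 ≤ Fb) (hFb : Fb ≤ 1 - v + B) (hFj : Fj ≤ Fa * Fb + 2 * u * v * e) :
    Fj ≤ 1 - (u + v - 3 * u * v) + (1 - v) * A + (1 - u) * B + A * B - 2 * u * v * (1 - e) := by
  have h : Fa * Fb ≤ (1 - u + A) * (1 - v + B) := mul_le_mul hFa hFb hFb0 (by linarith)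
  nlinarith [h]

/-- **Deep step: the margin `1/2` is hereditary.**  `0 ≤ F ≤ 1 − λ/2`, `0 ≤ F' ≤ 1 − λ'/2`,
`e ≤ 5/8` and `F'' ≤ FF' + 2λλ'e` give `F'' ≤ 1 − λ''/2` — with equality in the coefficients:
`(1−λ/2)(1−λ'/2) + (5/4)λλ' = 1 − (λ+λ'−3λλ')/2`. [folklore] -/
theorem deep_step {u v Fa Fb Fj e : ℝ} (hu0 : 0 ≤ u) (hv0 : 0 ≤ v) (hFa0 : 0 ≤ Fa)
    (hFa : Fa ≤ 1 - u / 2) (hFb0 : 0 ≤ Fb) (hFb : Fb ≤ 1 - v / 2) (he : e ≤ 5 / 8)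
    (hFj : Fj ≤ Fa * Fb + 2 * u * v * e) : Fj ≤ 1 - (u + v - 3 * u * v) / 2 := by
  have h : Fa * Fb ≤ (1 - u / 2) * (1 - v / 2) := mul_le_mul hFa hFb hFb0 (by linarith)
  have h2 : 2 * u * v * e ≤ 2 * u * v * (5 / 8) := mul_le_mul_of_nonneg_left he (by positivity)
  nlinarith [h, h2]

/-- **Base-fed step is blind.**  If one parent is a base with `F' ≤ 1 − (2/3)λ'` (excess at most a third
of its leg share) and the other merely passes, `0 ≤ F ≤ 1`, `λ ≤ 1/3`, then the child passes:
`F'' ≤ FF' + 2λλ' ≤ 1 − λ'(2/3 − 2λ) ≤ 1`. [folklore] -/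
theorem baseFed_step {u v Fa Fb Fj : ℝ} (hu : u ≤ 1 / 3) (hv0 : 0 ≤ v) (hFa : Fa ≤ 1)
    (hFb0 : 0 ≤ Fb) (hFb : Fb ≤ 1 - 2 / 3 * v) (hFj : Fj ≤ Fa * Fb + 2 * u * v) : Fj ≤ 1 := by
  have h : Fa * Fb ≤ 1 * (1 - 2 / 3 * v) := mul_le_mul hFa hFb hFb0 (by norm_num)
  nlinarith [h, mul_nonneg hv0 (by linarith : (0 : ℝ) ≤ 1 / 3 - u)]

/-- **Cross term, comparable parents.**  If `A ≤ θλ` (`λ ≤ 1/3`, `λ' ≤ 1`, `A, B, θ ≥ 0`) then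
`AB ≤ (θ/2)·((1−λ')A + (1−λ)B)`, because `λ ≤ (1−λ)/2`. [folklore] -/
theorem cross_term_comparable {u v A B θ : ℝ} (hu : u ≤ 1 / 3) (hv : v ≤ 1) (hA0 : 0 ≤ A)
    (hB0 : 0 ≤ B) (hθ : 0 ≤ θ) (hA : A ≤ θ * u) :
    A * B ≤ θ / 2 * ((1 - v) * A + (1 - u) * B) := by
  have h1 : A * B ≤ θ * u * B := mul_le_mul_of_nonneg_right hA hB0
  have h3 : θ * u * B ≤ θ * ((1 - u) / 2) * B :=
    mul_le_mul_of_nonneg_right (mul_le_mul_of_nonneg_left (by linarith) hθ) hB0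
  have h4 : 0 ≤ θ / 2 * ((1 - v) * A) := mul_nonneg (by positivity) (mul_nonneg (by linarith) hA0)
  nlinarith [h1, h3, h4]

/-- **Potential absorption.**  `(1 + c x)·exp(γx) ≤ exp(γy)` when `c ≤ γδ`, `(1+δ)x ≤ y`
(`γ, x ≥ 0`): the comparable step's factor `1 + Cσℓ^κ` is paid for by the growth `ℓ''^κ ≥ (1+δ)ℓ^κ`.
[folklore] -/
theorem potential_absorb {γ c δ x y : ℝ} (hγ : 0 ≤ γ) (hx : 0 ≤ x) (hc : c ≤ γ * δ)
    (hxy : (1 + δ) * x ≤ y) : (1 + c * x) * Real.exp (γ * x) ≤ Real.exp (γ * y) := by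
  have h1 : 1 + c * x ≤ Real.exp (c * x) := by linarith [Real.add_one_le_exp (c * x)]
  calc (1 + c * x) * Real.exp (γ * x) ≤ Real.exp (c * x) * Real.exp (γ * x) :=
        mul_le_mul_of_nonneg_right h1 (Real.exp_nonneg _)
    _ = Real.exp (c * x + γ * x) := by rw [Real.exp_add]
    _ ≤ Real.exp (γ * y) := Real.exp_le_exp.2 (by
        nlinarith [mul_le_mul_of_nonneg_right hc hx, mul_le_mul_of_nonneg_left hxy hγ])

/-- **Comparable lengths.**  `(1+ζ)x ≤ y`, `1 + δ ≤ (1+ζ)^κ` give `(1+δ)x^κ ≤ y^κ`. [folklore] -/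
theorem rpow_comparable {κ ζ δ x y : ℝ} (hκ : 0 ≤ κ) (hζ : 0 ≤ ζ) (hx : 0 ≤ x)
    (hδ : 1 + δ ≤ (1 + ζ) ^ κ) (hy : (1 + ζ) * x ≤ y) : (1 + δ) * x ^ κ ≤ y ^ κ := by
  have h1 : ((1 + ζ) * x) ^ κ ≤ y ^ κ := Real.rpow_le_rpow (by positivity) hy hκ
  rw [Real.mul_rpow (by positivity) hx] at h1
  exact le_trans (mul_le_mul_of_nonneg_right hδ (Real.rpow_nonneg hx κ)) h1

/-- **Exchange of leg shares.**  `λ₀ ≤ λ, λ'` (`λ₀ > 0`, `0 < κ < 1`) give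
`λ₀·(3λ')^{1−κ} ≤ λ'·(3λ)^{1−κ}` (as `λ₀ = λ₀^κ λ₀^{1−κ} ≤ λ'^κ λ^{1−κ}`). [folklore] -/
theorem lam_rpow_exchange {κ l₀ u v : ℝ} (hκ0 : 0 < κ) (hκ1 : κ < 1) (hl₀ : 0 < l₀) (hu : l₀ ≤ u)
    (hv : l₀ ≤ v) : l₀ * (3 * v) ^ (1 - κ) ≤ v * (3 * u) ^ (1 - κ) := by
  have hu0 : 0 < u := lt_of_lt_of_le hl₀ hu
  have hv0 : 0 < v := lt_of_lt_of_le hl₀ hv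
  have e1 : l₀ ^ κ * l₀ ^ (1 - κ) = l₀ := by
    rw [← Real.rpow_add hl₀, show κ + (1 - κ) = 1 by ring, Real.rpow_one]
  have e2 : v ^ κ * v ^ (1 - κ) = v := by
    rw [← Real.rpow_add hv0, show κ + (1 - κ) = 1 by ring, Real.rpow_one]
  rw [Real.mul_rpow (by norm_num) hv0.le, Real.mul_rpow (by norm_num) hu0.le]
  have h1 : l₀ ^ κ ≤ v ^ κ := Real.rpow_le_rpow hl₀.le hv hκ0.le
  have h2 : l₀ ^ (1 - κ) ≤ u ^ (1 - κ) := Real.rpow_le_rpow hl₀.le hu (by linarith)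
  have h3κ : 0 ≤ (3 : ℝ) ^ (1 - κ) := Real.rpow_nonneg (by norm_num) _
  calc l₀ * ((3 : ℝ) ^ (1 - κ) * v ^ (1 - κ))
      = (l₀ ^ κ * l₀ ^ (1 - κ)) * ((3 : ℝ) ^ (1 - κ) * v ^ (1 - κ)) := by rw [e1]
    _ ≤ (v ^ κ * u ^ (1 - κ)) * ((3 : ℝ) ^ (1 - κ) * v ^ (1 - κ)) := by
        apply mul_le_mul_of_nonneg_right _ (by positivity)
        exact mul_le_mul h1 h2 (Real.rpow_nonneg hl₀.le _) (Real.rpow_nonneg hv0.le _)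
    _ = (v ^ κ * v ^ (1 - κ)) * ((3 : ℝ) ^ (1 - κ) * u ^ (1 - κ)) := by ring
    _ = v * ((3 : ℝ) ^ (1 - κ) * u ^ (1 - κ)) := by rw [e2]

/-- **Potential over leg share.**  `Φ₀·3^{1−κ} ≤ C·λ₀^κ` and `λ₀ ≤ λ` give `Φ₀(3λ)^{1−κ} ≤ Cλ`.
[folklore] -/
theorem potential_over_lam {κ l₀ Φ₀ C x : ℝ} (hκ0 : 0 < κ) (hl₀ : 0 < l₀) (hC0 : 0 ≤ C)
    (hC : Φ₀ * 3 ^ (1 - κ) ≤ C * l₀ ^ κ) (hx : l₀ ≤ x) : Φ₀ * (3 * x) ^ (1 - κ) ≤ C * x := by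
  have hx0 : 0 < x := lt_of_lt_of_le hl₀ hx
  rw [Real.mul_rpow (by norm_num) hx0.le, ← mul_assoc]
  have h1 : l₀ ^ κ ≤ x ^ κ := Real.rpow_le_rpow hl₀.le hx hκ0.le
  have e : x ^ κ * x ^ (1 - κ) = x := by
    rw [← Real.rpow_add hx0, show κ + (1 - κ) = 1 by ring, Real.rpow_one]
  calc Φ₀ * 3 ^ (1 - κ) * x ^ (1 - κ) ≤ C * l₀ ^ κ * x ^ (1 - κ) :=
        mul_le_mul_of_nonneg_right hC (Real.rpow_nonneg hx0.le _)
    _ ≤ C * x ^ κ * x ^ (1 - κ) :=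
        mul_le_mul_of_nonneg_right (mul_le_mul_of_nonneg_left h1 hC0) (Real.rpow_nonneg hx0.le _)
    _ = C * x := by rw [mul_assoc, e]

/-- **Excess of a shallow node.**  With `x^κ ≤ B`, `γB ≤ log 2`, `Φ₀3^{1−κ} ≤ Cλ₀^κ`, `λ₀ ≤ λ`:
`Φ₀ exp(γx^κ) σ (3λ)^{1−κ} x^κ ≤ (2Cσx^κ)·λ`. [folklore] -/
theorem excess_le {κ l₀ Φ₀ C γ σ B x lam : ℝ} (hκ0 : 0 < κ) (hl₀ : 0 < l₀) (hΦ₀ : 0 ≤ Φ₀)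
    (hC0 : 0 ≤ C) (hC : Φ₀ * 3 ^ (1 - κ) ≤ C * l₀ ^ κ) (hσ : 0 ≤ σ) (hγ0 : 0 ≤ γ) (hx : 0 ≤ x)
    (hxB : x ^ κ ≤ B) (hγB : γ * B ≤ Real.log 2) (hlam : l₀ ≤ lam) :
    Φ₀ * Real.exp (γ * x ^ κ) * σ * ((3 * lam) ^ (1 - κ) * x ^ κ) ≤ 2 * C * σ * x ^ κ * lam := by
  have h2 : Real.exp (γ * x ^ κ) ≤ 2 := by
    calc Real.exp (γ * x ^ κ) ≤ Real.exp (Real.log 2) :=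
          Real.exp_le_exp.2 (le_trans (mul_le_mul_of_nonneg_left hxB hγ0) hγB)
      _ = 2 := Real.exp_log (by norm_num)
  have h3 := potential_over_lam hκ0 hl₀ hC0 hC hlam
  have hlam0 : 0 ≤ lam := le_trans hl₀.le hlam
  have hxk : 0 ≤ x ^ κ := Real.rpow_nonneg hx κ
  have h4 : 0 ≤ Φ₀ * (3 * lam) ^ (1 - κ) := mul_nonneg hΦ₀ (Real.rpow_nonneg (by linarith) _)
  calc Φ₀ * Real.exp (γ * x ^ κ) * σ * ((3 * lam) ^ (1 - κ) * x ^ κ)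
      = Real.exp (γ * x ^ κ) * (σ * x ^ κ) * (Φ₀ * (3 * lam) ^ (1 - κ)) := by ring
    _ ≤ 2 * (σ * x ^ κ) * (C * lam) := by
        apply mul_le_mul (mul_le_mul_of_nonneg_right h2 (by positivity)) h3 h4 (by positivity)
    _ = 2 * C * σ * x ^ κ * lam := by ring

/-! ## §2 The shallow step: leg-mass tax with the exact cross term -/

/-- **THE SHALLOW STEP** (both parents alive, `ℓ_b ≤ ℓ_a`, `ℓ_a^κ ≤ B`).  With the potential
`P(ℓ) = Φ₀ exp(γℓ^κ)`, parents obeying `0 ≤ F ≤ 1 − λ + P(ℓ)σ(3λ)^{1−κ}ℓ^κ` and the step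
`F'' ≤ F F' + 2λλ'`, the child obeys the same bound with `ℓ'' = ℓ_a + ℓ_b`, `λ'' = λ_a+λ_b−3λ_aλ_b`.
COMPARABLE parents (`ζℓ_a ≤ ℓ_b`): the cross term costs a factor `1 + Cσℓ_a^κ` (`cross_term_comparable`,
`legMass_step` of kernel XXXVI-A), absorbed by `ℓ''^κ ≥ (1+ζ)^κ ℓ_a^κ ≥ (1+δ)ℓ_a^κ` since `Cσ ≤ γδ`
(`potential_absorb`).  UNBALANCED parents (`ℓ_b < ζℓ_a`, `ζ^κ ≤ λ₀/2`): the small parent's whole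
contribution is at most `(λ_b/2)·A` and is paid by the contraction `(1 − λ_b)` of the big parent's excess
(`lam_rpow_exchange`); no growth factor at all.  Smallness used: `γB ≤ log 2`, `2CσB ≤ 1/2`.
[cite: Pan1984, Props. 16.4–16.5] [cite: Schonhage1981, §5] -/
theorem shallow_step {κ p l₀ Φ₀ C γ δ ζ σ B u v ℓa ℓb Fa Fb Fj : ℝ} (hκ0 : 0 < κ) (hκ1 : κ < 1)
    (hp : p = 1 / (1 - κ)) (h23 : ((2 : ℝ) / 3) ^ p = 1 / 2) (hl₀ : 0 < l₀) (hΦ₀ : 0 ≤ Φ₀)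
    (hC0 : 0 ≤ C) (hC : Φ₀ * 3 ^ (1 - κ) ≤ C * l₀ ^ κ) (hσ : 0 ≤ σ) (hγ0 : 0 ≤ γ)
    (hγ : C * σ ≤ γ * δ) (hζ0 : 0 < ζ) (hζ : ζ ^ κ ≤ l₀ / 2) (hδ : 1 + δ ≤ (1 + ζ) ^ κ)
    (hγB : γ * B ≤ Real.log 2) (hCB : 2 * C * σ * B ≤ 1 / 2)
    (hu0 : l₀ ≤ u) (hu : u ≤ 1 / 3) (hv0 : l₀ ≤ v) (hv : v ≤ 1 / 3)
    (hℓb : 0 ≤ ℓb) (hba : ℓb ≤ ℓa) (haB : ℓa ^ κ ≤ B) (hFa0 : 0 ≤ Fa)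
    (hFa : Fa ≤ 1 - u + Φ₀ * Real.exp (γ * ℓa ^ κ) * σ * ((3 * u) ^ (1 - κ) * ℓa ^ κ))
    (hFb0 : 0 ≤ Fb)
    (hFb : Fb ≤ 1 - v + Φ₀ * Real.exp (γ * ℓb ^ κ) * σ * ((3 * v) ^ (1 - κ) * ℓb ^ κ))
    (hFj : Fj ≤ Fa * Fb + 2 * u * v) :
    Fj ≤ 1 - (u + v - 3 * u * v) +
      Φ₀ * Real.exp (γ * (ℓa + ℓb) ^ κ) * σ *
        ((3 * (u + v - 3 * u * v)) ^ (1 - κ) * (ℓa + ℓb) ^ κ) := by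
  have hℓa : 0 ≤ ℓa := le_trans hℓb hba
  have hu00 : 0 ≤ u := le_trans hl₀.le hu0
  have hv00 : 0 ≤ v := le_trans hl₀.le hv0
  have hw := lam_step hu0 hu hv00 hv
  have hw0 : 0 ≤ u + v - 3 * u * v := le_trans hl₀.le hw.1
  have hℓj : ℓa ≤ ℓa + ℓb := by linarith
  -- the common potential Ψ = P(ℓ_a)σ and the two excess bounds A, B'
  set Ψ : ℝ := Φ₀ * Real.exp (γ * ℓa ^ κ) * σ with hΨ
  have hΨ0 : 0 ≤ Ψ := by positivity
  set A : ℝ := Ψ * ((3 * u) ^ (1 - κ) * ℓa ^ κ) with hA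
  obtain ⟨B', hB'⟩ : ∃ B' : ℝ, B' = Ψ * ((3 * v) ^ (1 - κ) * ℓb ^ κ) := ⟨_, rfl⟩
  have hA0 : 0 ≤ A := by positivity
  have hB0 : 0 ≤ B' := by rw [hB']; positivity
  have hexp_ba : Real.exp (γ * ℓb ^ κ) ≤ Real.exp (γ * ℓa ^ κ) :=
    Real.exp_le_exp.2 (mul_le_mul_of_nonneg_left (Real.rpow_le_rpow hℓb hba hκ0.le) hγ0)
  have hexp_aj : Real.exp (γ * ℓa ^ κ) ≤ Real.exp (γ * (ℓa + ℓb) ^ κ) :=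
    Real.exp_le_exp.2 (mul_le_mul_of_nonneg_left (Real.rpow_le_rpow hℓa hℓj hκ0.le) hγ0)
  have hFb' : Fb ≤ 1 - v + B' := by
    have : Φ₀ * Real.exp (γ * ℓb ^ κ) * σ * ((3 * v) ^ (1 - κ) * ℓb ^ κ) ≤ B' := by
      rw [hB', hΨ]
      apply mul_le_mul_of_nonneg_right _ (by positivity)
      exact mul_le_mul_of_nonneg_right (mul_le_mul_of_nonneg_left hexp_ba hΦ₀) hσ
    linarith
  -- A ≤ θ·u with θ = 2Cσℓ_a^κ ≤ 1/2
  have hAθ : A ≤ 2 * C * σ * ℓa ^ κ * u := excess_le hκ0 hl₀ hΦ₀ hC0 hC hσ hγ0 hℓa haB hγB hu0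
  have hθ0 : 0 ≤ 2 * C * σ * ℓa ^ κ := by positivity
  have hθ : 2 * C * σ * ℓa ^ κ ≤ 1 / 2 :=
    le_trans (mul_le_mul_of_nonneg_left haB (by positivity)) hCB
  -- normal form (e = 1)
  have hnf : Fj ≤ 1 - (u + v - 3 * u * v) + (1 - v) * A + (1 - u) * B' + A * B' := by
    have hFj1 : Fj ≤ Fa * Fb + 2 * u * v * 1 := by rw [mul_one]; exact hFj
    have h := product_normalForm hFa0 hFa hFb0 hFb' hFj1
    linarith
  -- the leg-mass tax for the potential Ψ (kernel XXXVI-A)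
  have hLM : (1 - u) * B' + (1 - v) * A ≤
      Ψ * ((3 * (u + v - 3 * u * v)) ^ (1 - κ) * (ℓa + ℓb) ^ κ) :=
    legMass_step hκ0 hκ1 hp h23 hΨ0 hu00 hu hv00 hv hℓa hℓb hA.le hB'.le
  have hR0 : 0 ≤ (3 * (u + v - 3 * u * v)) ^ (1 - κ) * (ℓa + ℓb) ^ κ :=
    mul_nonneg (Real.rpow_nonneg (by linarith) _) (Real.rpow_nonneg (by linarith) _)
  have hΨj : Ψ ≤ Φ₀ * Real.exp (γ * (ℓa + ℓb) ^ κ) * σ := by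
    rw [hΨ]; exact mul_le_mul_of_nonneg_right (mul_le_mul_of_nonneg_left hexp_aj hΦ₀) hσ
  rcases le_or_gt (ζ * ℓa) ℓb with hcomp | hsmall
  · -- CASE A: comparable parents
    have hcross := cross_term_comparable hu (show v ≤ 1 by linarith) hA0 hB0 hθ0 hAθ
    have h1 : Fj ≤ 1 - (u + v - 3 * u * v) +
        (1 + 2 * C * σ * ℓa ^ κ / 2) * ((1 - v) * A + (1 - u) * B') := by
      linarith [hnf, hcross]
    have h2 : (1 + 2 * C * σ * ℓa ^ κ / 2) * ((1 - v) * A + (1 - u) * B') ≤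
        (1 + 2 * C * σ * ℓa ^ κ / 2) *
          (Ψ * ((3 * (u + v - 3 * u * v)) ^ (1 - κ) * (ℓa + ℓb) ^ κ)) :=
      mul_le_mul_of_nonneg_left (by linarith [hLM]) (by positivity)
    have hδx : (1 + δ) * ℓa ^ κ ≤ (ℓa + ℓb) ^ κ :=
      rpow_comparable hκ0.le hζ0.le hℓa hδ (by linarith)
    have h3 : (1 + C * σ * ℓa ^ κ) * Real.exp (γ * ℓa ^ κ) ≤ Real.exp (γ * (ℓa + ℓb) ^ κ) :=
      potential_absorb hγ0 (Real.rpow_nonneg hℓa κ) hγ hδx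
    have h4 : (1 + 2 * C * σ * ℓa ^ κ / 2) *
          (Ψ * ((3 * (u + v - 3 * u * v)) ^ (1 - κ) * (ℓa + ℓb) ^ κ)) ≤
        Φ₀ * Real.exp (γ * (ℓa + ℓb) ^ κ) * σ *
          ((3 * (u + v - 3 * u * v)) ^ (1 - κ) * (ℓa + ℓb) ^ κ) := by
      have e : (1 + 2 * C * σ * ℓa ^ κ / 2) *
            (Ψ * ((3 * (u + v - 3 * u * v)) ^ (1 - κ) * (ℓa + ℓb) ^ κ)) =
          (Φ₀ * σ * ((3 * (u + v - 3 * u * v)) ^ (1 - κ) * (ℓa + ℓb) ^ κ)) *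
            ((1 + C * σ * ℓa ^ κ) * Real.exp (γ * ℓa ^ κ)) := by
        rw [hΨ]; ring
      have e' : Φ₀ * Real.exp (γ * (ℓa + ℓb) ^ κ) * σ *
            ((3 * (u + v - 3 * u * v)) ^ (1 - κ) * (ℓa + ℓb) ^ κ) =
          (Φ₀ * σ * ((3 * (u + v - 3 * u * v)) ^ (1 - κ) * (ℓa + ℓb) ^ κ)) *
            Real.exp (γ * (ℓa + ℓb) ^ κ) := by ring
      rw [e, e']
      exact mul_le_mul_of_nonneg_left h3 (mul_nonneg (mul_nonneg hΦ₀ hσ) hR0)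
    linarith [h1, h2, h4]
  · -- CASE B: unbalanced parents (ℓ_b < ζℓ_a): the small parent is paid by the contraction
    have hB'le : B' ≤ v / 2 * A := by
      have h1 : ℓb ^ κ ≤ ζ ^ κ * ℓa ^ κ := by
        rw [← Real.mul_rpow hζ0.le hℓa]
        exact Real.rpow_le_rpow hℓb hsmall.le hκ0.le
      have h2 : ℓb ^ κ ≤ l₀ / 2 * ℓa ^ κ :=
        le_trans h1 (mul_le_mul_of_nonneg_right hζ (Real.rpow_nonneg hℓa κ))
      have h3 : l₀ * (3 * v) ^ (1 - κ) ≤ v * (3 * u) ^ (1 - κ) :=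
        lam_rpow_exchange hκ0 hκ1 hl₀ hu0 hv0
      have h3v : 0 ≤ (3 * v) ^ (1 - κ) := Real.rpow_nonneg (by linarith) _
      calc B' = Ψ * ((3 * v) ^ (1 - κ) * ℓb ^ κ) := hB'
        _ ≤ Ψ * ((3 * v) ^ (1 - κ) * (l₀ / 2 * ℓa ^ κ)) :=
            mul_le_mul_of_nonneg_left (mul_le_mul_of_nonneg_left h2 h3v) hΨ0
        _ = Ψ * ℓa ^ κ / 2 * (l₀ * (3 * v) ^ (1 - κ)) := by ring
        _ ≤ Ψ * ℓa ^ κ / 2 * (v * (3 * u) ^ (1 - κ)) :=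
            mul_le_mul_of_nonneg_left h3 (by positivity)
        _ = v / 2 * A := by rw [hA]; ring
    have hAu : A ≤ 1 / 2 * u := le_trans hAθ (mul_le_mul_of_nonneg_right hθ hu00)
    have hA1 : A ≤ 1 := by linarith
    have hBv : B' ≤ v / 2 := by
      calc B' ≤ v / 2 * A := hB'le
        _ ≤ v / 2 * 1 := mul_le_mul_of_nonneg_left hA1 (by linarith)
        _ = v / 2 := mul_one _
    have hcrossB : A * B' ≤ A * (v / 2) := mul_le_mul_of_nonneg_left hBv hA0
    have huB : (1 - u) * B' ≤ B' := by linarith [mul_nonneg hu00 hB0]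
    have h5 : Fj ≤ 1 - (u + v - 3 * u * v) + A := by linarith [hnf, hcrossB, hB'le, huB]
    have hmono1 : (3 * u) ^ (1 - κ) ≤ (3 * (u + v - 3 * u * v)) ^ (1 - κ) :=
      Real.rpow_le_rpow (by linarith)
        (by linarith [mul_nonneg hv00 (by linarith : (0 : ℝ) ≤ 1 - 3 * u)]) (by linarith)
    have hmono2 : ℓa ^ κ ≤ (ℓa + ℓb) ^ κ := Real.rpow_le_rpow hℓa hℓj hκ0.le
    have h6 : A ≤ Φ₀ * Real.exp (γ * (ℓa + ℓb) ^ κ) * σ *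
        ((3 * (u + v - 3 * u * v)) ^ (1 - κ) * (ℓa + ℓb) ^ κ) := by
      rw [hA]
      exact mul_le_mul hΨj (mul_le_mul hmono1 hmono2 (Real.rpow_nonneg hℓa κ)
        (Real.rpow_nonneg (by linarith) _)) (by positivity) (le_trans hΨ0 hΨj)
    linarith [h5, h6]

end Summit.MatrixMultiplication.MatrixMultiplication.Theorems.FarEdgeDescentExactSteps

end
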